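import Summits.NavierStokesRegularity.NavierStokesRegularity.Theses.AmplitudeIndex
import Literature.Analysis.FluidPDE.LocalTypeI
import Literature.Analysis.FluidPDE.RusinSverakSingularPoint
import Literature.Analysis.FluidPDE.RusinSverakSingularPointProofs
import Literature.Analysis.FluidPDE.KatoFarFieldBound
import Literature.Analysis.FluidPDE.KatoLocalHolds
import Literature.Analysis.FluidPDE.TaoLocalisation
import Literature.Analysis.FluidPDE.EnstrophySplitting
import Literature.Analysis.FluidPDE.NSLerayHopfSereginProofs

/-!
# Birth skeleton (BC3) of the crux `AmplitudeIndex.ThresholdEnstrophyStable`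

(crux item `stmt-NavierStokesRegularity-10562`, rank 2 of route
`route-NavierStokesRegularity-AmplitudeIndex` (rev 2, open); tree path
`Cruxes/ThresholdEnstrophyStable/Lines/birth.lean`; registrar
`planner-skel-stmt-NavierStokesRegularity-10562-0`, 2026-08-17. The route predates the Lean birth
certificate; this file supplies BC3 retroactively. `ledger crux ls`: no `Disproof.lean`, no earlier
lines, no crux ideas for this crux at registration, so there is no disprover obligation
(`_false_without_`) to honour yet.)

THE CRUX (T, "threshold ⇒ index one, realised by the amplitude"). For `ν > 0` and a Clay datum
`u₀` (C^∞, divergence free, rapidly decaying) at a CRITICAL VISCOSITY — global Kato solutions for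
every `ν' > ν`, none at `ν` — all of whose Kato solutions obey the local scaled-`L³` Type-I bound
(`sup C(r, z; u) < ∞` over the parabolic sub-balls of some `Q_{r₀}(T, x₀)`, every `T`, `x₀`),
there is a TANGENT-FLOW-CLASS field `v` (ancient mild at unit viscosity, C^∞ on `t < 0`,
`‖v(t,x)‖ ≤ C/√(−t)`) which is ENSTROPHY-STABLE (the second variation `P_s(w,w)` of the
Leray-normalised enstrophy of its orbit `U(s) = lerayOrbit v s` is `≤ 0` on every test field
`w` that is `B_s`-orthogonal to the ten symmetry/amplitude directions) and has `curl v ≢ 0`.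

THE CUT — the route's own foreseen layer 2 ("TangentFlowBoundedOrbit → ThresholdIndexBound → T",
route header, TWO-LAYER PLAN), with the extraction step split into its KNOWN part and its OPEN
upgrade, so that no difficulty hides in an unnamed step:

* `stub_boundedAncientZoomLimit` [L–XL in Lean; KNOWN in print]: a Kato solution of a Clay datum
  with a backward singular point `(T, x₀)` (Albritton–Barker's `IsBackwardSingularPoint`) obeying
  the scaled-`L³` Type-I bound on some `Q_{r₀}(T, x₀)` has a ν-normalised ZOOM LIMIT
  `v = lim (c_k/ν) u(t_k + c_k² t/ν, x_k + c_k x)` in `L³_loc((−∞,0) × ℝ³)` (vertices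
  `(t_k, x_k) → (T, x₀)`, `t_k ≤ T`, scales `c_k ↓ 0`) which is an ancient mild solution, C^∞ and
  BOUNDED on `t < 0`, Type I in the scaled sense at ALL scales (`C(r, z; v) ≤ M` for every backward
  cylinder with vertex time `≤ 0`), and has non-vanishing vorticity. This is the forward half of
  Albritton–Barker 2019, Thm 1.1 (arXiv:1811.00502 §3: A–B Lemma 2.6 `C`-bound ⇒ `𝐈 < ∞`;
  persistence of singularities Prop. 2.3; Seregin–Šverák 2009 Thm 2.8 rescaling at near-maximum
  points ⇒ a MILD BOUNDED ancient limit; KNSS 2009 regularity of bounded mild ancient solutions),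
  run over the tree's Kato/Leray classes; `curl v ≢ 0` because a bounded curl- and divergence-free
  slice is constant in `x`, and an `x`-independent ancient field with `C(r, ·) ≤ M` at all scales
  vanishes (`C(r) ~ r³|b|³`).
* `stub_pastTypeIRate` [M–L; OPEN — the honest gap flagged by the route: "scaled Type I gives
  bounded blow-up limits (Seregin2014 Prop 3.10), not sup-rate"]: a C^∞, bounded ancient mild
  solution with the scaled Type-I bound at all scales decays at the self-similar rate,
  `‖v(t,x)‖ ≤ C/√(−t)` (`HasTypeITimeDecay`), i.e. its Leray orbit is bounded as `s → −∞`.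
  Automatic for backward DSS limits (Chae–Wolf 2017 Thm 1.1); parasitic `x`-independent `b(t)` are
  excluded by the all-scales bound; no Type-I ancient solution violating it is known (under KNSS's
  (L) there is none at all).
* `stub_thresholdTangentFlowsStable` [XL; OPEN — THE HEART, the route's "ThresholdIndexBound"]: at
  a critical viscosity (the crux's hypotheses verbatim) EVERY tangent flow in the class `𝒯`
  (zoom limit, in the above sense, of a Kato solution of `(ν, u₀)`) is enstrophy-stable: the one
  instability a codimension-one threshold affords is spent on the amplitude. Tangent flows at
  regular vertices are `0` (stable: `P(w,w) = −‖∇ω‖² − ¼‖ω‖²`), so the content sits at the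
  singular points of the maximal Kato solution.

`ThresholdEnstrophyStable_of : S1 → S2 → S3 → ThresholdEnstrophyStable` (hypotheses = the stub
statements through their name-keyed aliases `__Registered.stub_*`, conclusion = the route decl BY
NAME) is the real composition and uses PROVED tree theorems for the seam: a Clay datum lies in
`L³_σ` (`HasRapidSpatialDecay.lintegral_enorm_iteratedFDeriv_sq_lt_top`, `eLpNorm_three_pow_le`,
`VectorCalculus.IsDivFree.isWeaklyDivFree_holds`); no global Kato solution ⇒ the maximal Kato
solution has a backward singular point `(T_max, x_*)` (`exists_singularPoint_katoMaximalTime`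
with the discharged leaves `kato_local_holds`, `IsKatoSolutionOn.continuation_of_bounded_holds`,
`IsKatoSolutionOn.farField_bound_holds` — Lemarié-Rieusset 2016 Thm 15.1 (C), Rusin–Šverák 2011
§4); the crux's Type-I hypothesis at `(T_max, u, x_*)`; S1 extracts the bounded zoom limit, S2
upgrades it into `𝒯`, S3 makes it enstrophy-stable. `lean check`: sorries ONLY in the three
`stub_*` declarations. BC3 probes (registrar folder `bc/probe_*.lean`): for each stub `S`,
`S → ThresholdEnstrophyStable` and `S → NavierStokesRegularity` by
`first | exact? | simpa | aesop` FAIL — S1/S2 never mention the enstrophy form, S3 has no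
existence clause, none reaches Clay (A).
-/

noncomputable section

open MeasureTheory Set Filter Topology Function
open scoped ENNReal NNReal

namespace Summit.NavierStokesRegularity.NavierStokesRegularity.Cruxes.ThresholdEnstrophyStable.Birth

open Literature.Analysis.FluidPDE

set_option linter.unusedVariables false
set_option linter.dupNamespace false

local notation "ℝ³" => EuclideanSpace ℝ (Fin 3)

/-! ## Vocabulary — definitional abbreviations of the crux's own clauses -/

/-- **The tangent-flow class `𝒯`** — VERBATIM the first three conjuncts of the crux's conclusion:
ancient mild solution at unit viscosity (duality form), jointly `C^∞` on `(−∞,0) × ℝ³`, and the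
Type-I time rate `‖v(t,x)‖ ≤ C/√(−t)` (`U = lerayOrbit v` is a smooth bounded entire orbit). -/
def InTangentClass (v : ℝ → ℝ³ → ℝ³) : Prop :=
  IsAncientMildSolution 1 v ∧ ContDiffOn ℝ (⊤ : ℕ∞) (Function.uncurry v) (Set.Iio 0 ×ˢ Set.univ) ∧
    ∃ C : ℝ, HasTypeITimeDecay C v

/-- **Enstrophy stability** of `v` — VERBATIM the `let`-block of the crux (and of
`StableTangentFlowLiouville`): with `U s y = e^{−s/2} v(−e^{−s}, e^{−s/2} y)` (= `lerayOrbit v`),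
`P_s(w,w') = ∫ (−∇curl w : ∇curl w' − ¼ curl w · curl w' + (U×curl w + w×curl U) · curl curl w')`,
`B_s` its symmetrisation: for every `s` and every `C_c^∞` divergence-free `w` that is
`B_s`-orthogonal to the ten-parameter symmetry/amplitude family, `P_s(w,w) ≤ 0`. -/
def IsEnstrophyStable (v : ℝ → ℝ³ → ℝ³) : Prop :=
  (let curl := Literature.Analysis.FluidPDE.curl; let cross := Literature.Analysis.FluidPDE.cross; let U := fun (s : ℝ) (y : EuclideanSpace ℝ (Fin 3)) => Real.exp (-s / 2) • v (-Real.exp (-s)) (Real.exp (-s / 2) • y); let P := fun s w w' => ∫ y, (-(∑ i : Fin 3, inner ℝ (fderiv ℝ (curl w) y (EuclideanSpace.single i (1 : ℝ))) (fderiv ℝ (curl w') y (EuclideanSpace.single i (1 : ℝ)))) - (1 / 4 : ℝ) * inner ℝ (curl w y) (curl w' y) + inner ℝ (cross (U s y) (curl w y) + cross (w y) (curl (U s) y)) (curl (curl w') y)); let B := fun s w w' => P s w w' + P s w' w; ∀ s w, ContDiff ℝ (⊤ : ℕ∞) w → HasCompactSupport w → Literature.Analysis.FluidPDE.VectorCalculus.IsDivFree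 w → (∀ a (σ τ ρ : ℝ), ∀ A ∈ skewAdjoint (EuclideanSpace ℝ (Fin 3) →L[ℝ] EuclideanSpace ℝ (Fin 3)), B s w (fun y => fderiv ℝ (U s) y (a + σ • y + A y) + (σ + τ) • U s y - A (U s y) + ρ • Literature.Analysis.FluidPDE.timeDeriv U s y) = 0) → P s w w ≤ 0)

/-- **Non-vanishing vorticity** — VERBATIM the last conjunct of the crux's conclusion. -/
def HasVorticity (v : ℝ → ℝ³ → ℝ³) : Prop :=
  ∃ t < 0, ∃ x, Literature.Analysis.FluidPDE.curl (v t) x ≠ 0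

/-- **Scaled-`L³` Type I at the vertex `(T, x₀)`** — VERBATIM the conclusion of the crux's
Type-I hypothesis (= the conclusion of `MarginalBlowupTypeI`): for some `r₀ > 0`, the scaled cubic
quantity `C(r, z; u) = r⁻² ∬_{Q_r(z)} |u|³` (`cknC`) is bounded over all parabolic sub-balls
`Q_r(z) ⊆ Q_{r₀}(T, x₀)` (Seregin 2006; Albritton–Barker 2019 with Lemma 2.6). -/
def HasScaledTypeIAt (T : ℝ) (u : ℝ → ℝ³ → ℝ³) (x₀ : ℝ³) : Prop :=
  ∃ r₀ : ℝ, 0 < r₀ ∧ (⨆ (r : ℝ) (_ : 0 < r) (z : ℝ × EuclideanSpace ℝ (Fin 3)) (_ : Literature.Analysis.FluidPDE.parabolicCylinder r z ⊆ Literature.Analysis.FluidPDE.parabolicCylinder r₀ (T, x₀)), Literature.Analysis.FluidPDE.cknC r z u) < ⊤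

/-- **Zoom limits at a vertex.** `v` is an `L³_loc((−∞,0) × ℝ³)`-limit of ν-normalised parabolic
zooms of `u` about vertices `(t_k, x_k) → (T, x₀)` with `0 < t_k ≤ T` and scales `c_k ↓ 0`:
`v_k(t, x) = (c_k/ν) u(t_k + c_k² t/ν, x_k + c_k x)` (if `u` solves Navier–Stokes with viscosity
`ν` before `t_k`, then `v_k` solves it with viscosity `1` on `t < 0`; only values of `u` at times in
`(0, T)` enter the limit). The `L³_loc` mode is the one of the Type-I compactness theory
(Seregin 2006; Albritton–Barker 2019 Lemma 2.2) and is insensitive to the null sets on which a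
duality-form Kato solution is undetermined. -/
def IsZoomLimitAt (ν T : ℝ) (u : ℝ → ℝ³ → ℝ³) (x₀ : ℝ³) (v : ℝ → ℝ³ → ℝ³) : Prop :=
  ∃ (tv : ℕ → ℝ) (xv : ℕ → ℝ³) (c : ℕ → ℝ),
    (∀ k, 0 < c k) ∧ Tendsto c atTop (𝓝 0) ∧ (∀ k, tv k ∈ Set.Ioc 0 T) ∧
    Tendsto tv atTop (𝓝 T) ∧ Tendsto xv atTop (𝓝 x₀) ∧
    ∀ K : Set (ℝ × ℝ³), IsCompact K → K ⊆ Set.Iio 0 ×ˢ Set.univ →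
      Tendsto (fun k => eLpNorm (fun p : ℝ × ℝ³ =>
          (c k / ν) • u (tv k + c k ^ 2 * p.1 / ν) (xv k + c k • p.2) - v p.1 p.2)
        3 (volume.restrict K)) atTop (𝓝 0)

/-- **Tangent flows of the datum `u₀` at viscosity `ν`**: zoom limits, at some vertex `(T, x₀)`,
of some Kato solution of `(ν, u₀)` on `[0, T)`, `T > 0` (all Kato solutions of the datum agree
a.e. on their common life span, `kato_unique_holds`; at a regular vertex every zoom limit is `0`). -/
def IsTangentFlow (ν : ℝ) (u₀ : ℝ³ → ℝ³) (v : ℝ → ℝ³ → ℝ³) : Prop :=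
  ∃ (T : ℝ) (u : ℝ → ℝ³ → ℝ³) (x₀ : ℝ³), 0 < T ∧ IsKatoSolutionOn T ν u₀ u ∧ IsZoomLimitAt ν T u x₀ v

/-- **The vocabulary is DEFINITIONALLY the crux** (`Iff.rfl`). -/
theorem thresholdEnstrophyStable_iff :
    Theses.AmplitudeIndex.ThresholdEnstrophyStable ↔
      ∀ ν : ℝ, 0 < ν → ∀ u₀ : ℝ³ → ℝ³, ContDiff ℝ (⊤ : ℕ∞) u₀ → NSWave0.IsDivFree u₀ →
        HasRapidSpatialDecay u₀ → (∀ ν' : ℝ, ν < ν' → HasGlobalKatoSolution ν' u₀) →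
        ¬ HasGlobalKatoSolution ν u₀ →
        (∀ (T : ℝ) (u : ℝ → ℝ³ → ℝ³), 0 < T → IsKatoSolutionOn T ν u₀ u →
          ∀ x₀ : ℝ³, HasScaledTypeIAt T u x₀) →
        ∃ v : ℝ → ℝ³ → ℝ³, IsAncientMildSolution 1 v ∧
          ContDiffOn ℝ (⊤ : ℕ∞) (Function.uncurry v) (Set.Iio 0 ×ˢ Set.univ) ∧
          (∃ C : ℝ, HasTypeITimeDecay C v) ∧ IsEnstrophyStable v ∧ HasVorticity v :=
  Iff.rfl

/-! ## The stub statements -/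

/-- Statement of stub 1 (`stub_boundedAncientZoomLimit`): **a scaled-Type-I singular point of a
Kato solution has a bounded, smooth, Type-I-at-all-scales ancient zoom limit with vorticity.** -/
def BoundedAncientZoomLimit : Prop :=
  ∀ ν : ℝ, 0 < ν → ∀ u₀ : ℝ³ → ℝ³, ContDiff ℝ (⊤ : ℕ∞) u₀ → NSWave0.IsDivFree u₀ →
    HasRapidSpatialDecay u₀ →
    ∀ (T : ℝ) (u : ℝ → ℝ³ → ℝ³), 0 < T → IsKatoSolutionOn T ν u₀ u →
    ∀ x₀ : ℝ³, IsBackwardSingularPoint u (T, x₀) → HasScaledTypeIAt T u x₀ →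
      ∃ v : ℝ → ℝ³ → ℝ³, IsZoomLimitAt ν T u x₀ v ∧ IsAncientMildSolution 1 v ∧
        ContDiffOn ℝ (⊤ : ℕ∞) (Function.uncurry v) (Set.Iio 0 ×ˢ Set.univ) ∧
        (∃ B : ℝ, ∀ t < 0, ∀ x, ‖v t x‖ ≤ B) ∧
        (∃ M : ℝ≥0∞, M < ⊤ ∧ ∀ (r : ℝ) (z : ℝ × ℝ³), 0 < r → z.1 ≤ 0 → cknC r z v ≤ M) ∧
        HasVorticity v

/-- Statement of stub 2 (`stub_pastTypeIRate`): **a smooth bounded ancient mild solution with the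
scaled Type-I bound at all scales decays at the self-similar rate `‖v(t,x)‖ ≤ C/√(−t)`.** -/
def PastTypeIRate : Prop :=
  ∀ v : ℝ → ℝ³ → ℝ³, IsAncientMildSolution 1 v →
    ContDiffOn ℝ (⊤ : ℕ∞) (Function.uncurry v) (Set.Iio 0 ×ˢ Set.univ) →
    (∃ B : ℝ, ∀ t < 0, ∀ x, ‖v t x‖ ≤ B) →
    (∃ M : ℝ≥0∞, M < ⊤ ∧ ∀ (r : ℝ) (z : ℝ × ℝ³), 0 < r → z.1 ≤ 0 → cknC r z v ≤ M) →
    ∃ C : ℝ, HasTypeITimeDecay C v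

/-- Statement of stub 3 (`stub_thresholdTangentFlowsStable`): **at a critical viscosity with
scaled Type I (the crux's hypotheses verbatim), every tangent flow in `𝒯` is enstrophy-stable.** -/
def ThresholdTangentFlowsStable : Prop :=
  ∀ ν : ℝ, 0 < ν → ∀ u₀ : ℝ³ → ℝ³, ContDiff ℝ (⊤ : ℕ∞) u₀ → NSWave0.IsDivFree u₀ →
    HasRapidSpatialDecay u₀ → (∀ ν' : ℝ, ν < ν' → HasGlobalKatoSolution ν' u₀) →
    ¬ HasGlobalKatoSolution ν u₀ →
    (∀ (T : ℝ) (u : ℝ → ℝ³ → ℝ³), 0 < T → IsKatoSolutionOn T ν u₀ u →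
      ∀ x₀ : ℝ³, HasScaledTypeIAt T u x₀) →
    ∀ v : ℝ → ℝ³ → ℝ³, InTangentClass v → IsTangentFlow ν u₀ v → IsEnstrophyStable v

/-! ## The registered stubs -/

/-- **S1 `stub_boundedAncientZoomLimit` — BOUNDED ANCIENT ZOOM LIMIT AT A SCALED-TYPE-I SINGULAR
POINT** (size L–XL in Lean; KNOWN in print). For `ν > 0`, a Clay datum `u₀`, a Kato solution `u`
of `(ν, u₀)` on `[0, T)`, `T > 0`, and a backward singular point `(T, x₀)` of `u`
(`IsBackwardSingularPoint`: essentially unbounded on every `Q_r(T, x₀)`) at which the scaled-`L³`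
Type-I bound holds on some `Q_{r₀}(T, x₀)`: some ν-normalised zoom limit `v` (`IsZoomLimitAt`,
`L³_loc` on `t < 0`) is an ancient mild solution at unit viscosity, jointly C^∞ and bounded on
`(−∞,0) × ℝ³`, obeys `C(r, z; v) ≤ M < ∞` for every backward cylinder with vertex time `≤ 0`, and
has `curl v ≢ 0`. WHY PLAUSIBLE (= Albritton–Barker 2019 Thm 1.1, forward direction, over the
tree's classes): `u` agrees a.e. with the Leray solution of `u₀ ∈ L³_σ`
(`leray_solution_exists_of_memLp_three_holds`, `leray_solution_ae_eq_kato_holds`), a suitable weak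
solution in every parabolic ball below `T` (`IsSuitableWeakSolutionOn.isSuitableWeakSolutionInBall`);
the `C`-bound upgrades to `𝐈(Q) < ∞` (`albrittonBarker2019_lemma_2_6_holds`); zooms are exact
unit-viscosity solutions with the same `𝐈` (`cknC_nsZoom`, `typeIBound_nsZoom`,
`IsKatoSolutionOn.timeRescale`); compactness (`SuitableCompactness_holds`, A–B Lemma 2.2) and
persistence of singularities (`PersistenceOfSingularities_holds`, A–B Prop. 2.3) give a non-trivial
local-energy ancient limit with `𝐈 < ∞`; rescaling instead at near-maximum points `z_k → (T, x₀)`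
(Seregin–Šverák 2009 Thm 2.8; A–B §3 with Prop. 2.4) makes the limit MILD BOUNDED, hence C^∞
(KNSS 2009 regularity; tree: `knss2009_smoothing_holds`, `IsTypeIAncientMild` toolkit); its
vertices fit `IsZoomLimitAt` (`t_k ≤ T`, `x_k → x₀`, `c_k = 1/M_k → 0`). Vorticity: a bounded
slice with `curl = 0`, `div = 0` is harmonic and bounded, hence constant in `x`; an `x`-independent
ancient field with `C(r, ·) ≤ M` at all scales is `0` (`C(r) = c r³ ⨍|b|³`), contradicting
non-triviality. WHY IT MIGHT FAIL: only through the Lean distance — the duality-form Kato class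
must be bridged to Leray/suitable solutions below `T` (tree: `NSLerayHopfSereginLeaves`,
`RusinSverakLeraySolutions`) and the near-maximum rescaling must be phrased with vertices
`t_k ≤ T`. [AlbrittonBarker2019 Thm 1.1, Lemma 2.2, Prop. 2.3–2.4, Lemma 2.6 = arXiv:1811.00502;
SereginSverak2009 Thm 2.8; KNSS2009; Seregin2006] -/
theorem stub_boundedAncientZoomLimit : BoundedAncientZoomLimit := by
  sorry

/-- **S2 `stub_pastTypeIRate` — SCALED TYPE I AT ALL SCALES ⇒ THE SELF-SIMILAR RATE IN THE PAST**
(size M–L; OPEN). A jointly C^∞, bounded ancient mild solution `v` at unit viscosity with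
`C(r, z; v) ≤ M < ∞` for all backward cylinders with vertex time `≤ 0` satisfies
`‖v(t, x)‖ ≤ C/√(−t)` for all `t < 0` (`HasTypeITimeDecay C v`), i.e. its Leray orbit
`U(s) = e^{−s/2} v(−e^{−s}, e^{−s/2}·)` stays bounded as `s → −∞` — the upgrade from "scaled
Type I" to "sup-rate Type I" that the crux's class `𝒯` demands and that `MarginalBlowupTypeI` does
not supply (route header: "sup-rate Type I is more than M gives"; Seregin 2014 notes Prop. 3.10).
WHY PLAUSIBLE: the bound is scale-invariant and says `⨍_{Q_r} |v|³ ≲ M r⁻³`, i.e. `|v| ≲ r⁻¹` on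
average at scale `r = √(−t)`; it holds for every backward (discretely) self-similar ancient
solution (Chae–Wolf 2017 Thm 1.1: DSS local-Leray limits are smooth and Type I in sup-rate) and
for every candidate profile class in the tree (`IsTypeIAncientMild C v` has the rate built in);
`x`-independent parasitic fields `b(t)`, the only members of the duality-form class escaping
Liouville arguments, are killed by the all-scales bound; under KNSS's conjecture (L) the
hypothesis class is `{0}`. WHY IT MIGHT FAIL: `sup C ≤ M` carries no smallness, so ε-regularity
does not convert the averaged rate into a pointwise one; a Type-I ancient solution whose past
sup-norm decays slower than `(−t)^{−1/2}` on thin sets is not excluded by anything in print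
(Albritton–Barker 2019 §1 only reach `L^∞_t L^{3,∞}_x`-type information). Intended attack: KNSS
smoothing for bounded mild ancient solutions restarted at scale `√(−t)` plus a Calderón-type
splitting of the slice (Albritton–Barker 2019 §4), or Seregin–Šverák's point-picking run
backwards in time along the orbit. [AlbrittonBarker2019 §1, §4; ChaeWolf2017RemovingDSS Thm 1.1;
Seregin2014 Prop. 3.10; KNSS2009 (1.4)] -/
theorem stub_pastTypeIRate : PastTypeIRate := by
  sorry

/-- **S3 `stub_thresholdTangentFlowsStable` — THRESHOLD ⇒ EVERY TANGENT FLOW IS ENSTROPHY-STABLE**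
(size XL; OPEN — the heart of the crux, the route's "ThresholdIndexBound"). Under the crux's
hypotheses verbatim (`ν > 0`; Clay datum `u₀`; `HasGlobalKatoSolution ν' u₀` for all `ν' > ν`,
`¬ HasGlobalKatoSolution ν u₀` — for Clay data the amplitude threshold `A_c = 1` on the ray
`A • u₀`, `hasGlobalKatoSolution_smul_iff`; scaled-`L³` Type I for every Kato solution at every
vertex), every `v ∈ 𝒯` (`InTangentClass`) which is a tangent flow of `(ν, u₀)` (`IsTangentFlow`:
`L³_loc` zoom limit of a Kato solution of the datum) is enstrophy-stable (`IsEnstrophyStable`).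
WHY PLAUSIBLE (card simons-cone-amplitude-threshold-index, S1; route header WHY THIS LINE): the
threshold datum lies on the boundary of the OPEN set of `L³` data with global Kato solutions
(Gallagher–Iftimie–Planchon 2003 Thms 3.1–3.2; in tree `GIP2003_L3_stability`, literature debt of
the route), so its blow-up is a codimension-one phenomenon and should afford exactly one
instability modulo symmetries (Matano–Merle 2011 for the supercritical heat flow; centre-stable
manifolds at thresholds of critical dispersive equations); every orbit is enstrophy-UNSTABLE along
its own amplitude (support item `AmplitudeMountainPass`: `B(U,U) = ‖∇Ω‖² + ¼‖Ω‖² > 0`), which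
spends that one instability, leaving `P_s ≤ 0` off the ten-parameter span; tangent flows at
regular vertices are `0`, for which `P(w,w) = −‖∇curl w‖² − ¼‖curl w‖² ≤ 0` identically, so only
the singular points of the maximal Kato solution matter. WHY IT MIGHT FAIL (= the crux's): the
linearised operator `A_s` is non-normal — energy stability is strictly stronger than spectral
stability (Doering–Gibbon 1995 p. 37, `R_c^nonlin < R_c^lin`), so "one unstable Floquet
multiplier mod symmetries" need not give `P_s ≤ 0` on the `B_s`-complement, and pointwise-in-`s`
stability may fail at some DSS phases; the passage "codimension one in data ⇒ index one of the
tangent flow" needs a centre-stable-manifold theory for the profile semiflow in flat vorticity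
`L²` that does not exist yet (cf. `DssFarFieldSlaving`'s Gaussian Floquet theory). CHEAPEST
FALSIFIER (route header): the energy-vs-spectral index count along the Jia–Šverák/Guillod–Šverák
forward self-similar branch (arXiv:1704.00560). [GallagherIftimiePlanchon2003, MatanoMerle2011,
DoeringGibbon1995, JiaSverak2015, GuillodSverak2023, Seregin2014, AlbrittonBarker2019] -/
theorem stub_thresholdTangentFlowsStable : ThresholdTangentFlowsStable := by
  sorry

/-! ## Name-keyed aliases of the three statements — the hypotheses of `ThresholdEnstrophyStable_of`

The native skeleton audit (`#h21_check_skeleton`, run by `ledger skeleton check`) admits a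
hypothesis of the composing theorem only if its head constant is a registered obligation or is
NAMED like a declared stub; `__Registered.stub_X` is statement `X` under the registered stub's
short name (device of `Cruxes/ClockLaw/Lines/birth.lean`,
`AnomalousDissipation/…/Cruxes/MirrorFloorTG/Lines/birth.lean`; the `__` namespace is an
implementation detail, so the audit's stub report resolves each `stub_…` to the sorried theorem
above; the gate-reserved `@[stub]` attribute is not written by a planner). Each alias is an
`abbrev`, definitionally its statement. -/
namespace __Registered

/-- Alias of `BoundedAncientZoomLimit` keyed by the registered stub name. -/
abbrev stub_boundedAncientZoomLimit : Prop := BoundedAncientZoomLimit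
/-- Alias of `PastTypeIRate` keyed by the registered stub name. -/
abbrev stub_pastTypeIRate : Prop := PastTypeIRate
/-- Alias of `ThresholdTangentFlowsStable` keyed by the registered stub name. -/
abbrev stub_thresholdTangentFlowsStable : Prop := ThresholdTangentFlowsStable

end __Registered

/-! ## Proved: a Clay datum lies in `L³_σ`, and the composition -/

/-- **A Clay datum is an `L³` field** (rapid decay with `K = dim + 1` puts `u₀` in `L²`
(`HasRapidSpatialDecay.lintegral_enorm_iteratedFDeriv_sq_lt_top`), with `K = 0` in `L^∞`;
`‖u₀‖₃³ ≤ ‖u₀‖_∞ ‖u₀‖₂²`, `eLpNorm_three_pow_le`) — the pattern of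
`Theorems/TypeICertificateLadderNoBlowupToClay.lean`. -/
theorem memLp_three_of_clay {u₀ : ℝ³ → ℝ³} (hsm : ContDiff ℝ (⊤ : ℕ∞) u₀)
    (hdec : HasRapidSpatialDecay u₀) : MemLp u₀ 3 volume := by
  have hHk : ∀ n : ℕ, ∫⁻ x, ‖iteratedFDeriv ℝ n u₀ x‖ₑ ^ 2 < ⊤ :=
    hdec.lintegral_enorm_iteratedFDeriv_sq_lt_top
  have hmeas0 : AEStronglyMeasurable u₀ volume := hsm.continuous.aestronglyMeasurable
  have hL2 : ∫⁻ x, ‖u₀ x‖ₑ ^ 2 < ⊤ := by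
    refine lt_of_le_of_lt (le_of_eq (lintegral_congr fun x => ?_)) (hHk 0)
    rw [← ofReal_norm, ← ofReal_norm, norm_iteratedFDeriv_zero]
  have hu2 : MemLp u₀ 2 volume := ⟨hmeas0, eLpNorm_two_lt_top_of_lintegral_enorm_sq_lt_top hL2⟩
  obtain ⟨C₀, hC₀⟩ := hdec 0 0
  have hbd0 : ∀ x, ‖u₀ x‖ ≤ C₀ := fun x => by
    have h := hC₀ x
    rwa [pow_zero, one_mul, norm_iteratedFDeriv_zero] at h
  refine ⟨hmeas0, ?_⟩
  have h3 : eLpNorm u₀ 3 volume ^ 3 ≤ eLpNorm u₀ ⊤ volume * eLpNorm u₀ 2 volume ^ 2 :=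
    eLpNorm_three_pow_le hmeas0
  have htop : eLpNorm u₀ ⊤ volume ≤ ENNReal.ofReal C₀ := eLpNorm_top_le_of_bound hbd0
  have hfin : eLpNorm u₀ ⊤ volume * eLpNorm u₀ 2 volume ^ 2 < ⊤ :=
    ENNReal.mul_lt_top (htop.trans_lt ENNReal.ofReal_lt_top)
      (ENNReal.pow_lt_top hu2.eLpNorm_lt_top)
  by_contra hnot
  rw [not_lt, top_le_iff] at hnot
  rw [hnot, ENNReal.top_pow (by norm_num)] at h3
  exact absurd (h3.trans_lt hfin) (lt_irrefl _)

/-- **A Clay datum is weakly divergence free** (`C¹` and `div u₀ = 0`;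
`VectorCalculus.IsDivFree.isWeaklyDivFree_holds`; `NSWave0.IsDivFree` is verbatim
`VectorCalculus.IsDivFree`). -/
theorem isWeaklyDivFree_of_clay {u₀ : ℝ³ → ℝ³} (hsm : ContDiff ℝ (⊤ : ℕ∞) u₀)
    (hdiv : NSWave0.IsDivFree u₀) : IsWeaklyDivFree u₀ := by
  have hdiv' : VectorCalculus.IsDivFree u₀ := fun x => hdiv x
  exact VectorCalculus.IsDivFree.isWeaklyDivFree_holds hdiv' (hsm.of_le (mod_cast le_top))

/-- **`ThresholdEnstrophyStable` from the three stub statements** (the crux BY NAME; the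
hypotheses are the name-keyed aliases of the stub statements; no `sorry` of its own). Given the
crux's data `(ν, u₀)`: the datum is in `L³_σ` (`memLp_three_of_clay`, `isWeaklyDivFree_of_clay`);
since it has no global Kato solution, the maximal Kato solution `u` on `[0, T_max)` has a backward
singular point `(T_max, x_*)` (`exists_singularPoint_katoMaximalTime` over the PROVED leaves
`kato_local_holds`, `IsKatoSolutionOn.continuation_of_bounded_holds`,
`IsKatoSolutionOn.farField_bound_holds`); the crux's Type-I hypothesis applies to `(T_max, u, x_*)`;
S1 extracts a bounded smooth ancient zoom limit `v` with vorticity and the all-scales bound, S2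
gives it the Type-I time rate (so `v ∈ 𝒯`), and S3 — fed the tangent-flow witness
`(T_max, u, x_*)` — makes it enstrophy-stable. -/
theorem ThresholdEnstrophyStable_of :
    __Registered.stub_boundedAncientZoomLimit → __Registered.stub_pastTypeIRate →
      __Registered.stub_thresholdTangentFlowsStable →
        Theses.AmplitudeIndex.ThresholdEnstrophyStable := by
  intro hS1 hS2 hS3
  rw [thresholdEnstrophyStable_iff]
  intro ν hν u₀ hsm hdiv hdec hglob hng hTI
  -- the datum lies in the phase space `L³_σ`
  have hu3 : MemLp u₀ 3 volume := memLp_three_of_clay hsm hdec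
  have hwdiv : IsWeaklyDivFree u₀ := isWeaklyDivFree_of_clay hsm hdiv
  -- the maximal Kato solution and its backward singular point (PROVED tree theorems)
  obtain ⟨hpos, htop, xs, u, hu, hsing⟩ :=
    exists_singularPoint_katoMaximalTime kato_local_holds
      IsKatoSolutionOn.continuation_of_bounded_holds IsKatoSolutionOn.farField_bound_holds
      hν hu3 hwdiv hng
  have hT : 0 < (katoMaximalTime ν u₀).toReal := ENNReal.toReal_pos hpos.ne' htop.ne
  have hsing' : IsBackwardSingularPoint u ((katoMaximalTime ν u₀).toReal, xs) := hsing
  -- the crux's Type-I hypothesis at the singular point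
  have hTIx : HasScaledTypeIAt (katoMaximalTime ν u₀).toReal u xs :=
    hTI (katoMaximalTime ν u₀).toReal u hT hu xs
  -- S1: a bounded smooth ancient zoom limit with vorticity and the all-scales bound
  obtain ⟨v, hzoom, hmild, hsmooth, hbdd, hscaled, hcurl⟩ :=
    hS1 ν hν u₀ hsm hdiv hdec (katoMaximalTime ν u₀).toReal u hT hu xs hsing' hTIx
  -- S2: the self-similar rate in the past, so `v ∈ 𝒯`
  have hrate : ∃ C : ℝ, HasTypeITimeDecay C v := hS2 v hmild hsmooth hbdd hscaled
  have hclass : InTangentClass v := ⟨hmild, hsmooth, hrate⟩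
  -- S3: every tangent flow in `𝒯` of the threshold datum is enstrophy-stable
  have hstable : IsEnstrophyStable v :=
    hS3 ν hν u₀ hsm hdiv hdec hglob hng hTI v hclass
      ⟨(katoMaximalTime ν u₀).toReal, u, xs, hT, hu, hzoom⟩
  exact ⟨v, hmild, hsmooth, hrate, hstable, hcurl⟩

/-- WIRING CHECK: the three sorried stubs compose to a closed term of the crux's type (modulo their
`sorry`s). Deliberately an `example` (no constant of type `ThresholdEnstrophyStable` enters the
environment), so that a BC3 probe importing this file cannot close `stub → crux` by `exact?`
through a pre-composed witness. -/
example : Theses.AmplitudeIndex.ThresholdEnstrophyStable :=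
  ThresholdEnstrophyStable_of stub_boundedAncientZoomLimit stub_pastTypeIRate
    stub_thresholdTangentFlowsStable

end Summit.NavierStokesRegularity.NavierStokesRegularity.Cruxes.ThresholdEnstrophyStable.Birth

end
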